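import Summits.CriticalPhenomena.PercolationContinuityZ3.Theorems.PercNearOneGluingNoHeavyLowerTailGiantExchange
import Summits.CriticalPhenomena.PercolationContinuityZ3.Theorems.PercNearOneGluingNoHeavyLowerTailGiantDiamond
import Summits.CriticalPhenomena.PercolationContinuityZ3.Theorems.PercNearOneGluingNoHeavyLowerTailOwnConnection
import HarnessLib

/-!
# `NoHeavyLowerTail` (stmt-CriticalPhenomena-4575) — the giant attachment bound and "own heaviness helps most"
# (giant version of `ownConnection_cov_le`), on top of the lead's giant diamond

Support file (prover `prim-lf-7`, lemma factory "k-cluster conditional association"; `--supports stmt-CriticalPhenomena-4575`).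
No definitions, no named facts, no sorries.  Notation as in `…GiantExchange.lean`: relay set `A`, level `j`,
`|π(v)| = (A.filter fun a => ω ∈ openConn v a).card`, "light" `= |π| ≤ j`, "heavy" `= j+1 ≤ |π|`; throughout `|A| ≤ 2j+1`
(at most one heavy cluster — the ladder `|A| ∈ {2j, 2j+1}` of the crux and below), so that `{x light, y heavy} = {x ↮ y, y heavy}`.

* `giant_diamond`      `μ(o↔x, x light, y heavy)·μ(x heavy, y light) ≤ μ(o↔x, x heavy, y light)·μ(x light, y heavy)` — the lead's
  `giantDiamond` (`…GiantDiamond.lean`, any `A`, `j`, `x ≠ y`) restated with `openConn o x`, `j+1 ≤ ·` and the degenerate case `x = y`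
  included, in the form used below and by `…GiantHallCut.lean`;
* `giant_attach_le`    `μ(o↔x, x light, y heavy) ≤ μ(o↔x)·μ(x light, y heavy)` (BHK negative correlation given `{x ↮ y}` + Harris;
  NB the versions conditioned on `{x light}` or on "`x` outside the giant" are FALSE numerically);
* `giant_ownConnection_cov_le`  if `μ(y light) ≤ μ(x light)` then `Cov(1{o↔x}, 1{y heavy}) ≤ Cov(1{o↔x}, 1{x heavy})` —
  conjecture GV1 of prim-lf-7's CANDIDATES.md (0 violations in 73k exact/float checks), now a theorem; the sink version is
  `Theorems.ownConnection_cov_le` (V1), the first rung of kcluster's covariance-gluing chain (U), whose giant form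
  GU: `P(1 ≤ N ≤ j) ≤ E[r_J ; N ≥ 1]` is a crux-sufficient normal form of the (5,2) residual.
-/

noncomputable section

namespace Summit.CriticalPhenomena.PercolationContinuityZ3.Theorems

open MeasureTheory Set Literature.Probability.LatticeModels Literature.Probability.Percolation
open scoped Classical
open GiantExchange

variable {V : Type*}

/-- **Giant diamond** (the lead's `giantDiamond`, restated): `μ(o↔x, x light, y heavy) · μ(x heavy, y light) ≤
μ(o↔x, x heavy, y light) · μ(x light, y heavy)` for any relay set `A`, level `j`, vertices `o, x, y` (for `x = y` the left side vanishes).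
[cite: VandenbergHaggstromKahn2005, Thm. 1.5 (p. 7) — corollary; tree `giantDiamond`] -/
theorem giant_diamond [Fintype V] (w : Sym2 V → unitInterval) (A : Finset V) (o x y : V) (j : ℕ) :
    (prodBernoulli w).real (openConn o x ∩ {ω | (A.filter fun a => ω ∈ openConn x a).card ≤ j} ∩
        {ω | j + 1 ≤ (A.filter fun a => ω ∈ openConn y a).card}) *
      (prodBernoulli w).real ({ω | j + 1 ≤ (A.filter fun a => ω ∈ openConn x a).card} ∩
        {ω | (A.filter fun a => ω ∈ openConn y a).card ≤ j}) ≤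
    (prodBernoulli w).real (openConn o x ∩ {ω | j + 1 ≤ (A.filter fun a => ω ∈ openConn x a).card} ∩
        {ω | (A.filter fun a => ω ∈ openConn y a).card ≤ j}) *
      (prodBernoulli w).real ({ω | (A.filter fun a => ω ∈ openConn x a).card ≤ j} ∩
        {ω | j + 1 ≤ (A.filter fun a => ω ∈ openConn y a).card}) := by
  by_cases hxy : x = y
  · subst hxy
    have h0 : (openConn o x ∩ {ω | (A.filter fun a => ω ∈ openConn x a).card ≤ j} ∩
        {ω | j + 1 ≤ (A.filter fun a => ω ∈ openConn x a).card} : Set (BondConfig V)) = ∅ := by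
      ext ω
      simp only [mem_inter_iff, mem_setOf_eq, mem_empty_iff_false, iff_false, not_and, not_le]
      rintro ⟨_, h1⟩; omega
    rw [h0, measureReal_empty, zero_mul]
    exact mul_nonneg measureReal_nonneg measureReal_nonneg
  · have h := giantDiamond w A j hxy o
    have e1 : (openConn x o : Set (BondConfig V)) = openConn o x := by
      ext ω; exact ⟨fun h => SimpleGraph.Reachable.symm h, fun h => SimpleGraph.Reachable.symm h⟩
    have e2 : {ω : BondConfig V | j < (A.filter fun z => ω ∈ openConn x z).card} =
        {ω | j + 1 ≤ (A.filter fun a => ω ∈ openConn x a).card} := rfl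
    have e3 : {ω : BondConfig V | j < (A.filter fun z => ω ∈ openConn y z).card} =
        {ω | j + 1 ≤ (A.filter fun a => ω ∈ openConn y a).card} := rfl
    rw [e1, e2, e3] at h
    simpa only [inter_assoc] using h

/-- **Giant attachment bound (PROVED, `|A| ≤ 2j+1`).**  `μ(o↔x, x light, y heavy) ≤ μ(o↔x) · μ(x light, y heavy)`:
hanging on `x` is negatively correlated with "`x` outside the heavy cluster of `y`".  Proof: on the ladder
`{x light, y heavy} = {x ↮ y} ∩ {y heavy}`; given `{x ↮ y}` the events `{o ∈ C_x}` (type +) and `{y heavy}` (type −) are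
negatively correlated (BHK 2006 Thm 1.5 via `twoClusterExchange`), and `μ(o↔x, x↮y) ≤ μ(o↔x)μ(x↮y)` is Harris.
(The conditional versions given `{x light}` or `{x out}` are FALSE — prim-lf-7 CANDIDATES.md, batch 1, NC_G.) [this file] -/
theorem giant_attach_le [Fintype V] (w : Sym2 V → unitInterval) (A : Finset V) (o x y : V) (j : ℕ)
    (hA : A.card ≤ 2 * j + 1) :
    (prodBernoulli w).real (openConn o x ∩ {ω | (A.filter fun a => ω ∈ openConn x a).card ≤ j} ∩
        {ω | j + 1 ≤ (A.filter fun a => ω ∈ openConn y a).card}) ≤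
      (prodBernoulli w).real (openConn o x : Set (BondConfig V)) *
        (prodBernoulli w).real ({ω : BondConfig V | (A.filter fun a => ω ∈ openConn x a).card ≤ j} ∩
          {ω | j + 1 ≤ (A.filter fun a => ω ∈ openConn y a).card}) := by
  set μ := prodBernoulli w with hμ
  set Lx : Set (BondConfig V) := {ω | (A.filter fun a => ω ∈ openConn x a).card ≤ j} with hLx
  set Hy : Set (BondConfig V) := {ω | j + 1 ≤ (A.filter fun a => ω ∈ openConn y a).card} with hHy
  by_cases hxy : x = y
  · subst hxy
    have h0 : (openConn o x ∩ Lx ∩ Hy : Set (BondConfig V)) = ∅ := by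
      ext ω; simp only [mem_inter_iff, hLx, hHy, mem_setOf_eq, mem_empty_iff_false, iff_false]
      rintro ⟨⟨_, h1⟩, h2⟩; omega
    rw [h0, measureReal_empty]
    exact mul_nonneg measureReal_nonneg measureReal_nonneg
  set D : Set (BondConfig V) := (openConn x y)ᶜ with hD
  -- the ladder identity {x light, y heavy} = {x ↮ y, y heavy}
  have eF : (Lx ∩ Hy : Set (BondConfig V)) = D ∩ Hy := by
    ext ω; simp only [mem_inter_iff, hLx, hHy, hD, mem_compl_iff, mem_setOf_eq, openConn]
    constructor
    · rintro ⟨hl, hh⟩; exact ⟨not_reachable_of_light_heavy A hl hh, hh⟩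
    · rintro ⟨hn, hh⟩; exact ⟨light_of_not_reachable_of_heavy A hA hn hh, hh⟩
  have eQF : (openConn o x ∩ Lx ∩ Hy : Set (BondConfig V)) = D ∩ (openConn x o ∩ Hy) := by
    rw [inter_assoc, eF]
    ext ω; simp only [mem_inter_iff, hD, mem_compl_iff, openConn, mem_setOf_eq]
    constructor
    · rintro ⟨hox, hn, hh⟩; exact ⟨hn, hox.symm, hh⟩
    · rintro ⟨hn, hxo, hh⟩; exact ⟨hxo.symm, hn, hh⟩
  -- BHK: μ(D ∩ Q ∩ Hy) · μ(D) ≤ μ(D ∩ Q) · μ(D ∩ Hy)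
  have key := twoClusterExchange w hxy (A₁ := openConn x o) (A₂ := univ) (B₁ := Hy) (B₂ := univ)
    (fun ω ω' hs ht h => typePlus_openConn x y o hs ht h)
    (fun _ _ _ _ _ => mem_univ _)
    (fun ω ω' hs ht h => le_trans h (card_mono_of_cluster_subset A ht))
    (fun _ _ _ _ _ => mem_univ _)
  simp only [inter_univ] at key
  change μ.real (D ∩ (openConn x o ∩ Hy)) * μ.real D ≤ μ.real (D ∩ openConn x o) * μ.real (D ∩ Hy) at key
  -- Harris: μ(D ∩ Q) ≤ μ(Q) μ(D)
  have hH : μ.real (D ∩ openConn x o) ≤ μ.real (openConn o x : Set (BondConfig V)) * μ.real D := by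
    have h := prodBernoulli_harris_upper_lower_via_fibres w (isUpperSet_openConn o x) (isUpperSet_openConn x y).compl
    have e : (D ∩ openConn x o : Set (BondConfig V)) = openConn o x ∩ (openConn x y)ᶜ := by
      ext ω; simp only [mem_inter_iff, hD, mem_compl_iff, openConn, mem_setOf_eq]
      constructor
      · rintro ⟨hn, hxo⟩; exact ⟨hxo.symm, hn⟩
      · rintro ⟨hox, hn⟩; exact ⟨hn, hox.symm⟩
    rw [e]; exact h
  rw [eQF, eF]
  have hD0 : 0 ≤ μ.real D := measureReal_nonneg
  have hQ0 : 0 ≤ μ.real (openConn o x : Set (BondConfig V)) := measureReal_nonneg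
  have hB0 : 0 ≤ μ.real (D ∩ Hy) := measureReal_nonneg
  rcases hD0.eq_or_lt with hD00 | hDpos
  · have h1 : μ.real (D ∩ (openConn x o ∩ Hy)) ≤ μ.real D := measureReal_mono (fun ω hω => hω.1) (measure_ne_top _ _)
    have h2 : μ.real (D ∩ (openConn x o ∩ Hy)) = 0 := le_antisymm (by rw [← hD00] at h1; exact h1) measureReal_nonneg
    rw [h2]; exact mul_nonneg hQ0 hB0
  · have h3 : μ.real (D ∩ (openConn x o ∩ Hy)) * μ.real D ≤
        (μ.real (openConn o x : Set (BondConfig V)) * μ.real (D ∩ Hy)) * μ.real D := by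
      calc μ.real (D ∩ (openConn x o ∩ Hy)) * μ.real D ≤ μ.real (D ∩ openConn x o) * μ.real (D ∩ Hy) := key
        _ ≤ (μ.real (openConn o x : Set (BondConfig V)) * μ.real D) * μ.real (D ∩ Hy) :=
            mul_le_mul_of_nonneg_right hH hB0
        _ = (μ.real (openConn o x : Set (BondConfig V)) * μ.real (D ∩ Hy)) * μ.real D := by ring
    exact le_of_mul_le_mul_right h3 hDpos

/-- **Own heaviness helps most — the giant version of `Theorems.ownConnection_cov_le` (PROVED, `|A| ≤ 2j+1`).**
If `μ(y light) ≤ μ(x light)` (i.e. `x` is the more often light of the two — on the crux ladder this is the order of the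
guarded scores `Φ`) then `Cov(1{o↔x}, 1{y heavy}) ≤ Cov(1{o↔x}, 1{x heavy})`.  Proof = the sink proof verbatim:
trace decomposition over `{x heavy, y heavy}`, `giant_diamond`, `giant_attach_le`, and `μ(x heavy, y light) ≤ μ(x light, y heavy)`.
This was conjecture C1 (GV1) of prim-lf-7's batch 1 (0 violations in 73k checks). [this file] -/
theorem giant_ownConnection_cov_le [Fintype V] (w : Sym2 V → unitInterval) (A : Finset V) (o x y : V) (j : ℕ)
    (hA : A.card ≤ 2 * j + 1)
    (hr : (prodBernoulli w).real {ω : BondConfig V | (A.filter fun a => ω ∈ openConn y a).card ≤ j} ≤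
      (prodBernoulli w).real {ω : BondConfig V | (A.filter fun a => ω ∈ openConn x a).card ≤ j}) :
    (prodBernoulli w).real (openConn o x ∩ {ω | j + 1 ≤ (A.filter fun a => ω ∈ openConn y a).card}) -
        (prodBernoulli w).real (openConn o x : Set (BondConfig V)) *
          (prodBernoulli w).real {ω : BondConfig V | j + 1 ≤ (A.filter fun a => ω ∈ openConn y a).card} ≤
      (prodBernoulli w).real (openConn o x ∩ {ω | j + 1 ≤ (A.filter fun a => ω ∈ openConn x a).card}) -
        (prodBernoulli w).real (openConn o x : Set (BondConfig V)) *
          (prodBernoulli w).real {ω : BondConfig V | j + 1 ≤ (A.filter fun a => ω ∈ openConn x a).card} := by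
  set μ := prodBernoulli w with hμ
  set Lx : Set (BondConfig V) := {ω | (A.filter fun a => ω ∈ openConn x a).card ≤ j} with hLx
  set Hx : Set (BondConfig V) := {ω | j + 1 ≤ (A.filter fun a => ω ∈ openConn x a).card} with hHx
  set Ly : Set (BondConfig V) := {ω | (A.filter fun a => ω ∈ openConn y a).card ≤ j} with hLy
  set Hy : Set (BondConfig V) := {ω | j + 1 ≤ (A.filter fun a => ω ∈ openConn y a).card} with hHy
  have hdia := giant_diamond w A o x y j             -- QF * G ≤ QG * F
  have hatt := giant_attach_le w A o x y j hA        -- QF ≤ Q * F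
  set F := μ.real (Lx ∩ Hy) with hF
  set G := μ.real (Hx ∩ Ly) with hG
  set QF := μ.real (openConn o x ∩ Lx ∩ Hy) with hQF
  set QG := μ.real (openConn o x ∩ Hx ∩ Ly) with hQG
  set Q := μ.real (openConn o x : Set (BondConfig V)) with hQ
  set Z := μ.real (Lx ∩ Ly) with hZ
  set B2 := μ.real (Hx ∩ Hy) with hB2
  set QB2 := μ.real (openConn o x ∩ Hx ∩ Hy) with hQB2
  have cx : Lxᶜ = Hx := by ext ω; simp only [mem_compl_iff, hLx, hHx, mem_setOf_eq, not_le]; omega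
  have cy : Lyᶜ = Hy := by ext ω; simp only [mem_compl_iff, hLy, hHy, mem_setOf_eq, not_le]; omega
  have cx' : Hxᶜ = Lx := by rw [← cx, compl_compl]
  have cy' : Hyᶜ = Ly := by rw [← cy, compl_compl]
  -- bookkeeping
  have iLx : μ.real Lx = Z + F := by
    have := OwnDisconnection.split w Lx Ly; rw [cy] at this; linarith
  have iLy : μ.real Ly = Z + G := by
    have := OwnDisconnection.split w Ly Lx; rw [cx, inter_comm Ly Lx] at this
    have e : (Ly ∩ Hx : Set (BondConfig V)) = Hx ∩ Ly := inter_comm _ _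
    rw [e] at this; linarith
  have iHx : μ.real Hx = B2 + G := by
    have := OwnDisconnection.split w Hx Hy; rw [cy'] at this; linarith
  have iHy : μ.real Hy = B2 + F := by
    have := OwnDisconnection.split w Hy Hx; rw [cx', inter_comm Hy Hx] at this
    have e : (Hy ∩ Lx : Set (BondConfig V)) = Lx ∩ Hy := inter_comm _ _
    rw [e] at this; linarith
  have iQHx : μ.real (openConn o x ∩ Hx) = QB2 + QG := by
    have := OwnDisconnection.split w (openConn o x ∩ Hx) Hy
    rw [cy', inter_assoc, inter_assoc] at this
    have e1 : (openConn o x ∩ (Hx ∩ Hy) : Set (BondConfig V)) = openConn o x ∩ Hx ∩ Hy := (inter_assoc _ _ _).symm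
    have e2 : (openConn o x ∩ (Hx ∩ Ly) : Set (BondConfig V)) = openConn o x ∩ Hx ∩ Ly := (inter_assoc _ _ _).symm
    rw [e1, e2] at this; linarith
  have iQHy : μ.real (openConn o x ∩ Hy) = QB2 + QF := by
    have := OwnDisconnection.split w (openConn o x ∩ Hy) Hx
    rw [cx', inter_assoc, inter_assoc] at this
    have e1 : (openConn o x ∩ (Hy ∩ Hx) : Set (BondConfig V)) = openConn o x ∩ Hx ∩ Hy := by
      rw [inter_comm Hy Hx]; exact (inter_assoc _ _ _).symm
    have e2 : (openConn o x ∩ (Hy ∩ Lx) : Set (BondConfig V)) = openConn o x ∩ Lx ∩ Hy := by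
      rw [inter_comm Hy Lx]; exact (inter_assoc _ _ _).symm
    rw [e1, e2] at this; linarith
  have hFG : G ≤ F := by linarith
  have hF0 : 0 ≤ F := measureReal_nonneg
  have hG0 : 0 ≤ G := measureReal_nonneg
  have hQ0 : 0 ≤ Q := measureReal_nonneg
  have hQG0 : 0 ≤ QG := measureReal_nonneg
  have hQF0 : 0 ≤ QF := measureReal_nonneg
  rw [iQHy, iQHx, iHy, iHx]
  -- goal: QB2 + QF - Q (B2 + F) ≤ QB2 + QG - Q (B2 + G), i.e. QF - QG ≤ Q (F - G)
  rcases hF0.eq_or_lt with hF00 | hFpos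
  · have hQF' : QF = 0 := by
      have : QF ≤ Q * F := hatt
      rw [← hF00, mul_zero] at this; linarith
    have hG' : G = 0 := le_antisymm (by rw [hF00]; exact hFG) hG0
    rw [hQF', hG', ← hF00]; nlinarith
  · -- F > 0:  (QF - QG) F ≤ QF F - QF G = QF (F - G) ≤ Q F (F - G)
    have h1 : (QF - QG) * F ≤ QF * (F - G) := by nlinarith [hdia]
    have h2 : QF * (F - G) ≤ Q * F * (F - G) := mul_le_mul_of_nonneg_right hatt (by linarith)
    have h3 : (QF - QG) * F ≤ (Q * (F - G)) * F := by nlinarith [h1, h2]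
    have h4 : QF - QG ≤ Q * (F - G) := le_of_mul_le_mul_right h3 hFpos
    nlinarith [h4]

end Summit.CriticalPhenomena.PercolationContinuityZ3.Theorems

end
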